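import Summits.QuantumFields.YangMills.Theorems.BalabanUVNodesN15KingModelContinuumSymbolContinuity
import Summits.QuantumFields.YangMills.Theorems.BalabanUVNodesN15KingModelRGDeterminantIdentity
import Summits.QuantumFields.YangMills.Theorems.BalabanUVNodesN15KingModelFreeRGForms
import HarnessLib

/-!
# BalabanUVNodes ∕ N15 — THE KING-MODEL RUNG (PART Ε-v): KING's (3.93) LITERALLY BETWEEN TWO SCALES — `|ln N_k − ln N_{k+n}| ≤ |Ω|·C′·L^{−2k}` for part Τ's letter
# `kingEffLap`, in closed form — AND THE NORMALISATION∕DETERMINANT RESULTS OF PARTS Ε-k … Ε-u PACKAGED BY NAME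
# (Track A, DAG node N15 = NE2; FAN-OUT v1.1 §N15 s3 «KING-MODEL RUNG»; count-neutral)

HONEST FRAMING.  Count-neutral (cell `pub-ymgap`, seat `pub-ymgap-dag-n15-e` g40; `--supports stmt-QuantumFields-27366 --as helper` = K3⁸).
TEMPLATE LITERATURE: C. King, Commun. Math. Phys. **102** (1986) 649–677 [King1986], (3.89) p.668, (3.93) p.669 («|ln N_k − ln N_{k+n}| = ½|Σ_p ln[Δ^{(k+n)}(p)Δ^{(k)}(p)⁻¹]| ≤ …
≤ CL^{−2k}(L^kε)^{−d}|T|»), (2.4)–(2.6) p.652, (2.13)–(2.16) p.653, (4.5) p.670, Thm 3.4 (3.9) p.656.  Part Τ-d typed (3.93) DETERMINANT-FREE for its letter `kingEffLap L M a m² k =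
effLaplacian (L^k) M a_k L^{2k} m²` (`log_gaussNorm_rate`, constant `|Ω|·Θ·L^{−2k}·(1 + |ln(a+m²+4d)| + |ln δ|)` from the form comparison); parts Ε-n∕Ε-o∕Ε-p computed `ln N_k` in
closed form.  THIS FILE: §1 ★★ **`log_gaussNorm_kingEffLap`** (`ln N_k = ½|Ω|ln 2π − ½Σ_q ln effSym(q)` for Τ's letter), ★★★ **`abs_log_gaussNorm_kingEffLap_two_scales`** — KING's
(3.93) LITERALLY: `|ln N_k − ln N_{k+n}| ≤ ½|Ω|·C′·(L^{−2k} + L^{−2(k+n)}) ≤ |Ω|·C′·L^{−2k}` with the EXPLICIT `C′ = (a_∞⁻¹+m⁻²)·C_Δ(a)`, `C_Δ(a) = (8∕3)a²(a⁻¹+π²∕48+1∕3) + (4∕3)a`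
(part Ε-p's rate against `N_∞` twice); §2 ★★★ **`king_normalisation_package`** — the conjunction BY NAME, for a referee who wants one `#print axioms`, of: (1) `det Δ^{(K)} = Π_q effSym(q)`
(Ε-n); (2) the RG determinant identity `det A₀·det Δ^{(K)} = a^{|Ω|}·det B` (Ε-q); (3) `N_K = √(2π)^{|Ω|}∕√Π_q effSym(q)` and (4) `ln N_K = ½|Ω|ln 2π − ½Σ_q ln effSym(q)` (Ε-p); (5)
`𝒩(A₀)𝒩(Δ^{(K)}) = 𝒩(B)√(2π∕a)^{|Ω|}` (Ε-q); (6) `det Δ^{(∞)} = Π_q Δ^{(∞)}(p′(q))` (Ε-o); (7) `|ln N_K − ln N_∞| ≤ ½|Ω|C′L^{−2K}` (Ε-p); (8) the double limit `bzMean(ln Δ^{(K)}) →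
bzMean(ln Δ^{(∞)})` of the infinite-volume normalisation densities (Ε-u).

PRIOR TREE ART (used, not restated): parts Ε-n, Ε-o, Ε-p, Ε-q, Ε-t, Ε-u (the theorems named above), part Τ-d (`kingEffLap`), `King1986` (`aK`, `aK_pos`, `aInf`, `aInf_pos`), part Τ-a
(`gaussNorm`).  NOT Bałaban's covariant objects; NOT a node discharge (N15 is booked through n15-a's knit, untouched); nothing continuum-YM ∕ `ℝ⁴` ∕ OS ∕ Clay.  0 `sorry`, 0 `def`.

HONEST SCOPE.  King's `A = 0` free model on unit tori (dimension `d+1`), `L` odd `≥ 2`, `a, m² > 0`, `k ≥ 1`.  Locators: [King1986] (3.89) p.668, (3.93) p.669, (2.4)–(2.6) p.652,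
(2.13)–(2.16) p.653, (4.5) p.670, Thm 3.4 (3.9) p.656.
-/

noncomputable section

open scoped BigOperators Topology
open Finset Filter

namespace Summit.QuantumFields.YangMills.BalabanUVNodes.N15KingModelRung.TorusSpectral

open Literature.MathematicalPhysics.QuantumFieldTheory.Balaban1983to89.B5Prop11Plancherel (Tor fine sOf)
open Literature.MathematicalPhysics.QuantumFieldTheory.King1986 (aK aK_pos DeltaEff)
open Literature.MathematicalPhysics.QuantumFieldTheory.King1986.Torus
open Summit.QuantumFields.YangMills.BalabanUVNodes.N15KingModelRung.FreeField (gaussNorm kingEffLap)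

variable {d : ℕ} (L : ℕ) (M : Fin (d + 1) → ℕ) [hM : ∀ μ, NeZero (M μ)]

/-! ## §1 King's (3.93) literally, between two scales -/

/-- ★★ **PART Τ's LETTER IN CLOSED FORM**: `ln N_k := ln 𝒩(kingEffLap L M a m² k) = ½|Ω|·ln 2π − ½Σ_{q∈Ω̂} ln effSym(q)` (`k ≥ 1`, `L ≥ 2`, `a, m² > 0`). [cite: King1986, (3.89) p.668, (4.5) p.670] -/
theorem log_gaussNorm_kingEffLap (hL : 2 ≤ L) {a m2 : ℝ} (ha : 0 < a) (hm : 0 < m2) {k : ℕ} (hk : 1 ≤ k) :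
    haveI : NeZero L := ⟨by omega⟩
    Real.log (gaussNorm (kingEffLap L M a m2 k))
      = (Fintype.card (Tor M) : ℝ) / 2 * Real.log (2 * Real.pi) - 1 / 2 * ∑ q : Tor M, Real.log (effSym (L ^ k) M (aK a L k) (((L ^ k : ℕ) : ℝ) ^ 2) m2 q) := by
  haveI : NeZero L := ⟨by omega⟩
  have hL1 : (1 : ℝ) < L := by exact_mod_cast (show 1 < L by omega)
  exact log_gaussNorm_effLaplacian (L ^ k) M (aK_pos ha hL1 hk) (by positivity) hm

/-- ★★★ **KING's (3.93) LITERALLY**: `|ln N_k − ln N_{k+n}| ≤ ½|Ω|·C′·(L^{−2k} + L^{−2(k+n)})`, `C′ = (a_∞⁻¹+m⁻²)·C_Δ(a)` (`L` odd `≥ 2`, `a, m² > 0`, `k ≥ 1`, every `n`, every unit torus).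
[cite: King1986, (3.93) p.669, Lemma 4.3 (4.18) p.672] -/
theorem abs_log_gaussNorm_kingEffLap_two_scales (hLodd : Odd L) (hL : 2 ≤ L) {a m2 : ℝ} (ha : 0 < a) (hm : 0 < m2) {k : ℕ} (hk : 1 ≤ k) (n : ℕ) :
    haveI : NeZero L := ⟨by omega⟩
    |Real.log (gaussNorm (kingEffLap L M a m2 k)) - Real.log (gaussNorm (kingEffLap L M a m2 (k + n)))|
      ≤ 1 / 2 * ((Fintype.card (Tor M) : ℝ) * (((aInf a L)⁻¹ + m2⁻¹) * (8 / 3 * (a ^ 2 * (a⁻¹ + Real.pi ^ 2 / 48 + 1 / 3)) + 4 / 3 * a)))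
        * (((L : ℝ) ^ (2 * k))⁻¹ + ((L : ℝ) ^ (2 * (k + n)))⁻¹) := by
  haveI : NeZero L := ⟨by omega⟩
  have h1 := abs_log_gaussNorm_effLaplacian_sub_lim_le L M hLodd hL ha hm hk
  have h2 := abs_log_gaussNorm_effLaplacian_sub_lim_le L M hLodd hL ha hm (show 1 ≤ k + n by omega)
  rw [abs_sub_comm] at h2
  calc _ ≤ _ := abs_sub_le _ (Real.log (gaussNorm (Matrix.of fun b b' => effLaplacianLim L M a m2 b b'))) _
    _ ≤ _ := add_le_add h1 h2
    _ = _ := by ring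

/-- ★★ **(3.93) WITH ONE RATE**: `|ln N_k − ln N_{k+n}| ≤ |Ω|·C′·L^{−2k}` (`L^{−2(k+n)} ≤ L^{−2k}`). [cite: King1986, (3.93) p.669] -/
theorem abs_log_gaussNorm_kingEffLap_two_scales' (hLodd : Odd L) (hL : 2 ≤ L) {a m2 : ℝ} (ha : 0 < a) (hm : 0 < m2) {k : ℕ} (hk : 1 ≤ k) (n : ℕ) :
    haveI : NeZero L := ⟨by omega⟩
    |Real.log (gaussNorm (kingEffLap L M a m2 k)) - Real.log (gaussNorm (kingEffLap L M a m2 (k + n)))|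
      ≤ (Fintype.card (Tor M) : ℝ) * (((aInf a L)⁻¹ + m2⁻¹) * (8 / 3 * (a ^ 2 * (a⁻¹ + Real.pi ^ 2 / 48 + 1 / 3)) + 4 / 3 * a)) * ((L : ℝ) ^ (2 * k))⁻¹ := by
  haveI : NeZero L := ⟨by omega⟩
  have hL1 : (1 : ℝ) < L := by exact_mod_cast (show 1 < L by omega)
  have h := abs_log_gaussNorm_kingEffLap_two_scales L M hLodd hL ha hm hk n
  have hC : 0 ≤ (Fintype.card (Tor M) : ℝ) * (((aInf a L)⁻¹ + m2⁻¹) * (8 / 3 * (a ^ 2 * (a⁻¹ + Real.pi ^ 2 / 48 + 1 / 3)) + 4 / 3 * a)) := by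
    have := aInf_pos ha hL1
    positivity
  have hmono : ((L : ℝ) ^ (2 * (k + n)))⁻¹ ≤ ((L : ℝ) ^ (2 * k))⁻¹ :=
    inv_anti₀ (by positivity) (pow_le_pow_right₀ hL1.le (by omega))
  calc _ ≤ _ := h
    _ ≤ 1 / 2 * ((Fintype.card (Tor M) : ℝ) * (((aInf a L)⁻¹ + m2⁻¹) * (8 / 3 * (a ^ 2 * (a⁻¹ + Real.pi ^ 2 / 48 + 1 / 3)) + 4 / 3 * a)))
        * (((L : ℝ) ^ (2 * k))⁻¹ + ((L : ℝ) ^ (2 * k))⁻¹) := by gcongr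
    _ = _ := by ring

/-! ## §2 The package -/

/-- ★★★ **PARTS Ε-k … Ε-u BY NAME — KING's NORMALISATIONS ARE DETERMINANTS, IN CLOSED FORM, WITH (3.93)'s RATE AND BOTH LIMITS.**  For `L` odd `≥ 2`, every unit torus, `N ≥ 1`,
`a, m² > 0`: (1) `det_effLaplacian_eq_prod_effSym`; (2) `det_fineOp_mul_det_effLaplacian`; (3) `gaussNorm_effLaplacian_eq`; (4) `log_gaussNorm_effLaplacian`;
(5) `gaussNorm_fineOp_mul_gaussNorm_effLaplacian`; (6) `det_effLaplacianLim_eq_prod`; (7) `abs_log_gaussNorm_effLaplacian_sub_lim_le`; (8) `tendsto_bzMean_log_DeltaEff`.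
[cite: King1986, (3.89) p.668, (3.93) p.669, (2.4)–(2.6) p.652, (2.13)–(2.16) p.653, (4.5) p.670, Thm 3.4 (3.9) p.656] -/
theorem king_normalisation_package (hLodd : Odd L) (hL : 2 ≤ L) (N : ℕ) [NeZero N] (hN1 : 1 ≤ N) {a m2 : ℝ} (ha : 0 < a) (hm : 0 < m2) :
    haveI : NeZero L := ⟨by omega⟩
    -- (1) the block-field determinant by plane waves
    ((effLaplacian N M a ((N : ℝ) ^ 2) m2).det = ∏ q : Tor M, effSym N M a ((N : ℝ) ^ 2) m2 q) ∧
    -- (2) the RG determinant identity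
    ((fineOp N M a ((N : ℝ) ^ 2) m2).det * (effLaplacian N M a ((N : ℝ) ^ 2) m2).det = a ^ Fintype.card (Tor M) * (lapF (fine N M) ((N : ℝ) ^ 2) m2).det) ∧
    -- (3) the normalisation is a determinant
    (gaussNorm (effLaplacian N M a ((N : ℝ) ^ 2) m2) = Real.sqrt (2 * Real.pi) ^ Fintype.card (Tor M) / Real.sqrt (∏ q : Tor M, effSym N M a ((N : ℝ) ^ 2) m2 q)) ∧
    -- (4) King's (3.89) literally
    (Real.log (gaussNorm (effLaplacian N M a ((N : ℝ) ^ 2) m2))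
      = (Fintype.card (Tor M) : ℝ) / 2 * Real.log (2 * Real.pi) - 1 / 2 * ∑ q : Tor M, Real.log (effSym N M a ((N : ℝ) ^ 2) m2 q)) ∧
    -- (5) the Gaussian bookkeeping of the RG step
    (gaussNorm (fineOp N M a ((N : ℝ) ^ 2) m2) * gaussNorm (effLaplacian N M a ((N : ℝ) ^ 2) m2)
      = gaussNorm (lapF (fine N M) ((N : ℝ) ^ 2) m2) * Real.sqrt (2 * Real.pi / a) ^ Fintype.card (Tor M)) ∧
    -- (6) the continuum determinant
    ((Matrix.of fun b b' => effLaplacianLim L M a m2 b b').det = ∏ q : Tor M, effSymLim a L m2 (sOf M q)) ∧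
    -- (7) (3.93) for the normalisations against `N_∞`
    (∀ K : ℕ, 1 ≤ K → |Real.log (gaussNorm (effLaplacian (L ^ K) M (aK a L K) (((L ^ K : ℕ) : ℝ) ^ 2) m2))
        - Real.log (gaussNorm (Matrix.of fun b b' => effLaplacianLim L M a m2 b b'))|
      ≤ 1 / 2 * ((Fintype.card (Tor M) : ℝ) * (((aInf a L)⁻¹ + m2⁻¹) * (8 / 3 * (a ^ 2 * (a⁻¹ + Real.pi ^ 2 / 48 + 1 / 3)) + 4 / 3 * a))
        * ((L : ℝ) ^ (2 * K))⁻¹)) ∧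
    -- (8) the double limit of the infinite-volume normalisation densities
    Tendsto (fun K : ℕ => bzMean (fun p : Fin (d + 1) → ℝ => Real.log (DeltaEff (aK a L K) (L ^ K) m2 p)) d) atTop
      (𝓝 (bzMean (fun p : Fin (d + 1) → ℝ => Real.log (effSymLim a L m2 p)) d)) :=
  ⟨det_effLaplacian_eq_prod_effSym N M ha.le (by positivity) hm,
    det_fineOp_mul_det_effLaplacian N M hN1 ha hm,
    gaussNorm_effLaplacian_eq N M ha (by positivity) hm,
    log_gaussNorm_effLaplacian N M ha (by positivity) hm,
    gaussNorm_fineOp_mul_gaussNorm_effLaplacian N M hN1 ha hm,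
    det_effLaplacianLim_eq_prod L M hLodd hL ha hm,
    fun _ hK => abs_log_gaussNorm_effLaplacian_sub_lim_le L M hLodd hL ha hm hK,
    tendsto_bzMean_log_DeltaEff L hLodd hL ha hm⟩

end Summit.QuantumFields.YangMills.BalabanUVNodes.N15KingModelRung.TorusSpectral

end
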